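import Literature.Probability.RandomPlanarGeometry.HexSAWPathRigidity
import Literature.Barriers.CriticalPhenomena.ParafermionicHalfCauchyRiemann

/-!
# The Duminil-Copin–Smirnov boundary identity of a door, in terms of exit masses

Helper file for the crux `NoFoldBound` (stmt-CriticalPhenomena-8296) of the route `SAWDevelopingMap`
(sub-problem `SAWScalingLimit` of `CriticalPhenomena`), programme FLAT / PEELED LP of the lead seats
c9–c10 (`FLAT-FINITE.md`, `FLAT-LEAN-DESIGN.md` on the item), brick L1(E). The EQUALITY rows of the
peeled linear programme are the identities of Duminil-Copin–Smirnov for the sub-domains `D = S ∖ K`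
rooted at a local door `s`: Lemma 1 summed over `D` ("Sum the relation (1) over all vertices …
values at interior mid-edges disappear", Ann. of Math. 175 (2012), §3) gives
`hexFlux D F_s = 0` (`HexGreen.hexFlux`, `HexGreen.sum_relations_eq_hexFlux` of the barrier file
`ParafermionicHalfCauchyRiemann.lean`), a sum over the boundary darts `(y, w)` of `D`, and at a
boundary mid-edge the observable is a RIGID PHASE times a nonnegative real EXIT MASS: every walk
`s → {y,w}` has the same winding (`HexMidEdgeSAW.winding_eq_of_mem_boundary`,
`HexSAWPathRigidity.lean`), read off from any one witness walk. This file packages exactly these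
two steps for an arbitrary finite simply connected domain and an arbitrary fugacity where possible:

* `observable_eq_phase_mul_mass` — for `D` simply connected, `s, m ∈ ∂D` and a witness
  `γ₀ : s → m`: `F_s(m) = e^{-i(5/8)W(γ₀)} · Σ_{γ : s → m} x^{ℓ(γ)}` (the sum cast to `ℂ`);
* `observable_eq_zero_of_isEmpty` — no walk, no value;
* `sum_boundary_darts_observable_eq_zero` — the critical identity as an explicit double sum over
  `y ∈ D`, `w ∈ nbrs y ∖ D` of `(mid{y,w} − c(y)) · F_s({y,w}) = 0`.

Rows of the LP are obtained from the last identity by substituting the first two dart by dart and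
grouping darts with equal coefficient·phase into classes.
-/

noncomputable section

open scoped BigOperators Classical
open Literature.Probability.LatticeModels Literature.Probability.RandomPlanarGeometry.SAW
open Literature.Barriers.CriticalPhenomena Literature.Barriers.CriticalPhenomena.HexGreen

namespace Summit.CriticalPhenomena.SAWScalingLimit.Theorems.SAWDevelopingMapNoFoldBound.Peel

variable {D : Finset HexVertex} {s m : Sym2 HexVertex}

/-- The observable as phase-weighted masses: at any target, `F_s(m) = Σ_γ e^{-iσW(γ)} x^{ℓ(γ)}`
with the real mass cast to `ℂ` (unfolding). -/
theorem observable_eq_sum_weight (x σ : ℝ) :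
    hexParafermionicObservable D s x σ m =
      ∑ γ : HexMidEdgeSAW D s m, Complex.exp (-Complex.I * σ * (γ.winding : ℝ)) * (x : ℂ) ^ γ.length :=
  rfl

/-- **Rigid phase times mass.** In a simply connected domain, between two BOUNDARY mid-edges, the
critical-spin observable is the common phase `e^{-i(5/8)W}` of the walks (read off from any witness
`γ₀`) times the real exit mass `Σ_γ x^{ℓ(γ)}`. -/
theorem observable_eq_phase_mul_mass : ∀ {D : Finset HexVertex} {s m : Sym2 HexVertex}, hexDomainSimplyConnected D → s ∈ hexDomainBoundary D → m ∈ hexDomainBoundary D → ∀ (γ₀ : HexMidEdgeSAW D s m) (x : ℝ), hexParafermionicObservable D s x (5 / 8) m = Complex.exp (-Complex.I * (5 / 8 : ℝ) * (γ₀.winding : ℝ)) * ((∑ γ : HexMidEdgeSAW D s m, x ^ γ.length : ℝ) : ℂ) := by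
  intro D s m hD hs hm γ₀ x
  rw [observable_eq_sum_weight, Complex.ofReal_sum, Finset.mul_sum]
  refine Finset.sum_congr rfl fun γ _ => ?_
  rw [HexMidEdgeSAW.winding_eq_of_mem_boundary hD hs hm γ γ₀, Complex.ofReal_pow]

/-- No walk from `s` to `m`: the observable vanishes there, and so does the mass. -/
theorem observable_eq_zero_of_isEmpty (h : IsEmpty (HexMidEdgeSAW D s m)) (x σ : ℝ) :
    hexParafermionicObservable D s x σ m = 0 ∧ (∑ γ : HexMidEdgeSAW D s m, x ^ γ.length) = 0 := by
  constructor
  · rw [observable_eq_sum_weight]; exact Finset.sum_eq_zero fun γ _ => (h.false γ).elim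
  · exact Finset.sum_eq_zero fun γ _ => (h.false γ).elim

/-- The mass of a nonempty family of walks is positive (`x > 0`): used to orient inequalities. -/
theorem sum_pow_length_pos (γ₀ : HexMidEdgeSAW D s m) {x : ℝ} (hx : 0 < x) :
    0 < ∑ γ : HexMidEdgeSAW D s m, x ^ γ.length :=
  lt_of_lt_of_le (pow_pos hx γ₀.length)
    (Finset.single_le_sum (fun γ _ => le_of_lt (pow_pos hx γ.length)) (Finset.mem_univ γ₀))

/-- **The critical boundary identity of a door, dart by dart.** For `D` simply connected and a
boundary mid-edge `s`, the Duminil-Copin–Smirnov relations summed over `D` leave only the boundary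
darts: `Σ_{y ∈ D} Σ_{w ∼ y, w ∉ D} (mid{y,w} − c(y)) · F_s({y,w}) = 0` at `x = x_c`, `σ = 5/8`. -/
theorem sum_boundary_darts_observable_eq_zero : ∀ {D : Finset HexVertex} {s : Sym2 HexVertex}, hexDomainSimplyConnected D → s ∈ hexDomainBoundary D → (∑ y ∈ D, ∑ w ∈ (Literature.Barriers.CriticalPhenomena.HexGreen.nbrs y).filter (· ∉ D), (hexMidpoint s(y, w) - hexCenter y) * hexParafermionicObservable D s hexCriticalFugacity (5 / 8) s(y, w)) = 0 := by
  intro D s hD hs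
  have h := lemma1_iff.1 DuminilCopinSmirnov2012_lemma1_holds D hD s hs
  have h0 := hexFlux_eq_zero_of_satisfiesVertexRelations h
  simpa only [hexFlux, HexKernel.term, hexCriticalFugacity] using h0

/-- The same identity with the door's own dart made explicit: writing `s = {p, q}` (`p ∉ D ∋ q`),
the dart `(q, p)` contributes `(mid s − c(q)) · 1` (`F_s(s) = 1`), all other boundary darts
`(mid − c) · F_s`. -/
theorem door_term_add_sum_eq_zero : ∀ {D : Finset HexVertex} {p q : HexVertex}, hexDomainSimplyConnected D → p ∉ D → q ∈ D → hexGraph.Adj p q → (hexMidpoint s(q, p) - hexCenter q) + ((∑ y ∈ D, ∑ w ∈ (nbrs y).filter (· ∉ D), (hexMidpoint s(y, w) - hexCenter y) * hexParafermionicObservable D s(p, q) hexCriticalFugacity (5 / 8) s(y, w)) - (hexMidpoint s(q, p) - hexCenter q) * hexParafermionicObservable D s(p, q) hexCriticalFugacity (5 / 8) s(q, p)) = 0 := by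
  intro D p q hD hp hq hpq
  have hs : s(p, q) ∈ hexDomainBoundary D :=
    ⟨(SimpleGraph.mem_edgeSet hexGraph).2 hpq, p, q, rfl, hq, hp⟩
  have hself : hexParafermionicObservable D s(p, q) hexCriticalFugacity (5 / 8) s(q, p) = 1 := by
    rw [Sym2.eq_swap (a := q) (b := p)]; exact hexParafermionicObservable_self hs _ _
  rw [sum_boundary_darts_observable_eq_zero hD hs, hself]
  ring

end Summit.CriticalPhenomena.SAWScalingLimit.Theorems.SAWDevelopingMapNoFoldBound.Peel
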